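import Mathlib
import HarnessLib
import Summits.HubbardSuperconductivity.HubbardSuperconductivity.Theorems.KLProgrammeKLRegimeEngineV8Defs

/-!
# v2 `G`-part of the engine package: `klEngGeo2` = `klEngGeo` with the ONE-SCALE BUBBLE MASS `bhi := 2^{18}` (certified-crude sign-blind slice
# pair mass, k3c2-p2 HOME/STATUS 22:31:39Z: ≈ 1.8·10⁵ per `L²` today), the ph transfer-Lipschitz amplitude `K := 2^{24}` (k3c2-p2 21:09:17Z /
# 22:17:26Z: ≈ 2·10⁶ needed, `2^{10}` cannot hold it) and the freezing constant `CF := 2^{52}` (so the ph freezing sum still closes)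
# (cell gate-hubbard-kl, seat p1 g7 = package author; registrant of the gen-4 engine skeleton decides whether to import it)

Why.  The `G`-profiles are UPPER bounds the ENGINE must PROVE (`EngineP4`: `∃ G, G.WF ∧ …`): (m) of (E2-v8) asks `Σ|w| ≤ G.bhi` for the true slice
pair weights, whose certified mass today is `≈ 1.8·10⁵ ≫ 4` (`klzf_sum_norm_pair_le`, crude DOS count `2200` × sup-product); the below-resolution
branch of `phGain` carries the transfer-Lipschitz constant `K`, certified `≈ 2·10⁶ ≫ 2^{10}`.  With `K = 2^{24}` the ph freezing sum of
`klgp_sum_range_phGainOf_le` is `(4/3)2^{24} + 4/3 + 4·2^{24}·2^{24} + 2·2^{24}√e₀ + 1 < 2^{52}`, hence `CF := 2^{52}`.  Everything else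
(`atop/abot/blo/cloc/θ/a/ζ/Z/aplus/ppGain/cE4/S/Bf/SL`) is `klEngGeo`'s verbatim.  Numbers are placeholders of record with head-room (re-issue under
new names if a stub needs more); nothing about the model is asserted.  `klEngGeo2_wf` PROVED (same proof as `klEngGeo_wf`).
APPEND (v3): `klEngGeo3` = `klEngGeo2` with `bhi := 2^{24}` (room for the full step-`n` rung weight incl. mixed-scale pairs), `klEngGeo3_wf`.
-/

noncomputable section

namespace Summit.HubbardSuperconductivity.HubbardSuperconductivity.Theorems.EngineV8

set_option linter.dupNamespace false -- summit = problem name (single-conjunct summit), D-0017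

open Real Finset
open Summit.HubbardSuperconductivity.HubbardSuperconductivity.Theorems.KLRegimeSplit

/-- **`klEngGeo2` — the engine's absolute constants `G`, v2**: `klEngGeo` with `bhi := 2^{18}`, `phGain`'s `K := 2^{24}`, `CF := 2^{52}`. -/
def klEngGeo2 : GeoConsts where
  atop := fun _ => 2 ^ 10
  abot := fun _ => 2 ^ 10
  blo := 0
  bhi := 2 ^ 18
  cloc := 2 ^ 10
  θ := 1 / 2
  a := fun _ => 2 ^ 24
  ζ := fun n => ((2 : ℝ) ^ n)⁻¹
  Z := 2
  aplus := 2 ^ 24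
  ppGain := fun n ρ => ppGainOf (2 ^ 24) (2 ^ 24) 0 klE0 n n ρ
  phGain := fun n ρ => phGainOf (2 ^ 24) (2 ^ 24) (2 ^ 24) (2 ^ 24) 0 klE0 n n (max ρ 0)
  CF := 2 ^ 52
  cE4 := 2 ^ 10
  S := fun _ => 2 ^ 10
  Bf := 2 ^ 10
  SL := 2 ^ 10

/-- `klEngGeo2.bhi = 2^{18}`. -/
theorem klEngGeo2_bhi : klEngGeo2.bhi = 2 ^ 18 := rfl

/-- `klEngGeo2.CF = 2^{52}`. -/
theorem klEngGeo2_CF : klEngGeo2.CF = 2 ^ 52 := rfl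

/-- The old bubble-mass bound is dominated: `klEngGeo.bhi ≤ klEngGeo2.bhi`. -/
theorem klEngGeo_bhi_le_klEngGeo2_bhi : klEngGeo.bhi ≤ klEngGeo2.bhi := by norm_num [klEngGeo, klEngGeo2]

/-- **`klEngGeo2` is well formed** (signs, `θ = 1/2`, drive mass `Σ 2^{-n} ≤ 2`, and the two FREEZING sums of the gain profiles dominated by
`CF = 2^{52}`). -/
theorem klEngGeo2_wf : klEngGeo2.WF := by
  refine ⟨fun _ => by norm_num [klEngGeo2], fun _ => by norm_num [klEngGeo2], by norm_num [klEngGeo2], by norm_num [klEngGeo2],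
    by norm_num [klEngGeo2], by norm_num [klEngGeo2], by norm_num [klEngGeo2], fun _ => by norm_num [klEngGeo2],
    fun n => by simp [klEngGeo2], fun N => ?_, by norm_num [klEngGeo2], fun n ρ => ?_, fun n ρ => ?_, by norm_num [klEngGeo2],
    fun ρ N hρ => ?_, fun ρ t N hρ => ?_, by norm_num [klEngGeo2], fun _ => by norm_num [klEngGeo2], by norm_num [klEngGeo2],
    by norm_num [klEngGeo2]⟩
  · -- drive mass
    show ∑ n ∈ range N, ((2 : ℝ) ^ n)⁻¹ ≤ 2
    exact klgp_sum_range_inv_two_pow_le N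
  · -- pp gain ≥ 0
    show 0 ≤ ppGainOf (2 ^ 24) (2 ^ 24) 0 klE0 n n ρ
    exact klgp_ppGainOf_nonneg (by norm_num) (by norm_num) (le_of_lt (by norm_num [klE0] : (0 : ℝ) < klE0)) 0 n n ρ
  · -- ph gain ≥ 0
    show 0 ≤ phGainOf (2 ^ 24) (2 ^ 24) (2 ^ 24) (2 ^ 24) 0 klE0 n n (max ρ 0)
    exact klgp_phGainOf_nonneg (by norm_num) (by norm_num) (by norm_num) (by norm_num) le_rfl (le_of_lt (by norm_num [klE0] : (0 : ℝ) < klE0)) n n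
      (le_max_right _ _)
  · -- ph freezing sum, uniform in the transfer
    show ∑ n ∈ range N, phGainOf (2 ^ 24) (2 ^ 24) (2 ^ 24) (2 ^ 24) 0 klE0 n n (max ρ 0) ≤ 2 ^ 52
    rw [max_eq_left hρ]
    cases N with
    | zero => simp
    | succ m =>
      rw [sum_congr rfl fun n _ => phGainOf_w0_indep (2 ^ 24) (2 ^ 24) (2 ^ 24) (2 ^ 24) klE0 n n m ρ]
      have h := klgp_sum_range_phGainOf_le (C₀ := 2 ^ 24) (K := 2 ^ 24) (C₁ := 2 ^ 24) (C₂ := 2 ^ 24) (w := 0) (e₀ := klE0)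
        (by norm_num) (by norm_num) (by norm_num) (by norm_num) le_rfl (by norm_num [klE0] : (0 : ℝ) < klE0) m hρ
      have hs := sqrt_klE0_le_one
      have h0 : (3 : ℝ) * 2 ^ 24 * 0 / klE0 = 0 := by simp
      rw [h0] at h
      have : (4 : ℝ) / 3 * 2 ^ 24 + 4 / 3 + 4 * 2 ^ 24 * 2 ^ 24 + 2 * 2 ^ 24 * Real.sqrt klE0 + (0 + 1) ≤ 2 ^ 52 := by
        nlinarith [Real.sqrt_nonneg klE0]
      exact h.trans this
  · -- pp freezing sum below the transfer's own scale
    show ∑ n ∈ Ioc t N, ppGainOf (2 ^ 24) (2 ^ 24) 0 klE0 n n ρ ≤ 2 ^ 52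
    rw [sum_congr rfl fun n _ => ppGainOf_w0_indep (2 ^ 24) (2 ^ 24) klE0 n n N ρ]
    have h := klgp_sum_Ioc_ppGainOf_le (C₁ := 2 ^ 24) (C₂ := 2 ^ 24) (w := 0) (e₀ := klE0)
      (by norm_num) (by norm_num) le_rfl (le_of_lt (by norm_num [klE0] : (0 : ℝ) < klE0)) N t hρ
    have hs := sqrt_klE0_le_one
    have : (2 : ℝ) * 0 + 1 + 8 / 3 * 2 ^ 24 * klE0 + 2 ^ 24 * Real.sqrt klE0 ≤ 2 ^ 52 := by
      have : klE0 = 1 / 32 := by norm_num [klE0]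
      nlinarith [Real.sqrt_nonneg klE0]
    exact h.trans this

/-! ## v3 (append): `bhi := 2^{24}` — room for the FULL step-`n` rung weight (same-slice pair + the mixed pairs with the ≤ 5 partner slices
`n−4 … n−1` reachable from a pair-class `Qm`, STATUS p1 g7 00:2xZ ENGINE NOTE: ≈ 11 × the crude per-slice mass ≈ 2^{21}) -/

/-- **`klEngGeo3` — the engine's absolute constants `G`, v3**: `klEngGeo2` with `bhi := 2^{24}` (everything else as v2). -/
def klEngGeo3 : GeoConsts where
  atop := fun _ => 2 ^ 10
  abot := fun _ => 2 ^ 10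
  blo := 0
  bhi := 2 ^ 24
  cloc := 2 ^ 10
  θ := 1 / 2
  a := fun _ => 2 ^ 24
  ζ := fun n => ((2 : ℝ) ^ n)⁻¹
  Z := 2
  aplus := 2 ^ 24
  ppGain := fun n ρ => ppGainOf (2 ^ 24) (2 ^ 24) 0 klE0 n n ρ
  phGain := fun n ρ => phGainOf (2 ^ 24) (2 ^ 24) (2 ^ 24) (2 ^ 24) 0 klE0 n n (max ρ 0)
  CF := 2 ^ 52
  cE4 := 2 ^ 10
  S := fun _ => 2 ^ 10
  Bf := 2 ^ 10
  SL := 2 ^ 10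

/-- `klEngGeo3.bhi = 2^{24}`. -/
theorem klEngGeo3_bhi : klEngGeo3.bhi = 2 ^ 24 := rfl

/-- `klEngGeo3.CF = 2^{52}`. -/
theorem klEngGeo3_CF : klEngGeo3.CF = 2 ^ 52 := rfl

/-- `klEngGeo2.bhi ≤ klEngGeo3.bhi`. -/
theorem klEngGeo2_bhi_le_klEngGeo3_bhi : klEngGeo2.bhi ≤ klEngGeo3.bhi := by norm_num [klEngGeo2, klEngGeo3]

/-- **`klEngGeo3` is well formed** (same proof as `klEngGeo2_wf`; `bhi` enters only `blo ≤ bhi`). -/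
theorem klEngGeo3_wf : klEngGeo3.WF := by
  refine ⟨fun _ => by norm_num [klEngGeo3], fun _ => by norm_num [klEngGeo3], by norm_num [klEngGeo3], by norm_num [klEngGeo3],
    by norm_num [klEngGeo3], by norm_num [klEngGeo3], by norm_num [klEngGeo3], fun _ => by norm_num [klEngGeo3],
    fun n => by simp [klEngGeo3], fun N => ?_, by norm_num [klEngGeo3], fun n ρ => ?_, fun n ρ => ?_, by norm_num [klEngGeo3],
    fun ρ N hρ => ?_, fun ρ t N hρ => ?_, by norm_num [klEngGeo3], fun _ => by norm_num [klEngGeo3], by norm_num [klEngGeo3],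
    by norm_num [klEngGeo3]⟩
  · -- drive mass
    show ∑ n ∈ range N, ((2 : ℝ) ^ n)⁻¹ ≤ 2
    exact klgp_sum_range_inv_two_pow_le N
  · -- pp gain ≥ 0
    show 0 ≤ ppGainOf (2 ^ 24) (2 ^ 24) 0 klE0 n n ρ
    exact klgp_ppGainOf_nonneg (by norm_num) (by norm_num) (le_of_lt (by norm_num [klE0] : (0 : ℝ) < klE0)) 0 n n ρ
  · -- ph gain ≥ 0
    show 0 ≤ phGainOf (2 ^ 24) (2 ^ 24) (2 ^ 24) (2 ^ 24) 0 klE0 n n (max ρ 0)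
    exact klgp_phGainOf_nonneg (by norm_num) (by norm_num) (by norm_num) (by norm_num) le_rfl (le_of_lt (by norm_num [klE0] : (0 : ℝ) < klE0)) n n
      (le_max_right _ _)
  · -- ph freezing sum, uniform in the transfer
    show ∑ n ∈ range N, phGainOf (2 ^ 24) (2 ^ 24) (2 ^ 24) (2 ^ 24) 0 klE0 n n (max ρ 0) ≤ 2 ^ 52
    rw [max_eq_left hρ]
    cases N with
    | zero => simp
    | succ m =>
      rw [sum_congr rfl fun n _ => phGainOf_w0_indep (2 ^ 24) (2 ^ 24) (2 ^ 24) (2 ^ 24) klE0 n n m ρ]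
      have h := klgp_sum_range_phGainOf_le (C₀ := 2 ^ 24) (K := 2 ^ 24) (C₁ := 2 ^ 24) (C₂ := 2 ^ 24) (w := 0) (e₀ := klE0)
        (by norm_num) (by norm_num) (by norm_num) (by norm_num) le_rfl (by norm_num [klE0] : (0 : ℝ) < klE0) m hρ
      have hs := sqrt_klE0_le_one
      have h0 : (3 : ℝ) * 2 ^ 24 * 0 / klE0 = 0 := by simp
      rw [h0] at h
      have : (4 : ℝ) / 3 * 2 ^ 24 + 4 / 3 + 4 * 2 ^ 24 * 2 ^ 24 + 2 * 2 ^ 24 * Real.sqrt klE0 + (0 + 1) ≤ 2 ^ 52 := by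
        nlinarith [Real.sqrt_nonneg klE0]
      exact h.trans this
  · -- pp freezing sum below the transfer's own scale
    show ∑ n ∈ Ioc t N, ppGainOf (2 ^ 24) (2 ^ 24) 0 klE0 n n ρ ≤ 2 ^ 52
    rw [sum_congr rfl fun n _ => ppGainOf_w0_indep (2 ^ 24) (2 ^ 24) klE0 n n N ρ]
    have h := klgp_sum_Ioc_ppGainOf_le (C₁ := 2 ^ 24) (C₂ := 2 ^ 24) (w := 0) (e₀ := klE0)
      (by norm_num) (by norm_num) le_rfl (le_of_lt (by norm_num [klE0] : (0 : ℝ) < klE0)) N t hρ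
    have hs := sqrt_klE0_le_one
    have : (2 : ℝ) * 0 + 1 + 8 / 3 * 2 ^ 24 * klE0 + 2 ^ 24 * Real.sqrt klE0 ≤ 2 ^ 52 := by
      have : klE0 = 1 / 32 := by norm_num [klE0]
      nlinarith [Real.sqrt_nonneg klE0]
    exact h.trans this

end Summit.HubbardSuperconductivity.HubbardSuperconductivity.Theorems.EngineV8

end
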